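import Summits.ValiantsHypothesis.ValiantsHypothesis.Theorems.KPlusLogSqLawStaticPathOptDefs
import Summits.ValiantsHypothesis.ValiantsHypothesis.Theorems.KPlusLogSqLawStaticPathTrain

/-!
# Route «KPlusLogSqLaw» — block optima on a path: the junction identity and the dynamic programme

HONEST FRAMING.  Helper toward the crux `WeakLifting` (item `stmt-ValiantsHypothesis-19561`, route `KPlusLogSqLaw`, cell `pub-symmetroid`,
seat val-sym-lift-p3 g6, 2026-08-27) on the line of its witness-plan stub `stub_tridiagonalSectorB` (tropical twin of the STATIC tridiagonal
sector = parametric max-weight independent set on a path, val-sym-lift-p4 g6 `HOME/val-sym-lift-p4/STATIC-PATH-NLOGN.md`).  For the block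
optima `opt i len` of `KPlusLogSqLawStaticPathOptDefs.lean`: the JUNCTION IDENTITY of the paper's §6 — splitting the block `i+1..i+l₁+l₂`
after item `i+l₁`, either that item or the next one is unused: `opt i (l₁+l₂) = max (opt i (l₁-1) + opt (i+l₁) l₂) (opt i l₁ + opt (i+l₁+1) (l₂-1))`
(`opt_junction`) — and the identification of the block optimum with the left-to-right dynamic programme `F` of `KPlusLogSqLawStaticPathTrainDefs.lean`
on the shifted items (`opt_eq_F`), so that the difference «block minus block-without-its-last-item» is the LEFT TRAIN (`opt_sub_eq_Δ`).
Statements about a path DP; nothing here asserts anything about `WeakLifting`, `TropicalB`, `KPlusLogSqLaw`, the stub in its window,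
`MatrixDescartes` (stmt-ValiantsHypothesis-18050) or `VP ≠ VNP`.
-/

set_option linter.dupNamespace false
set_option autoImplicit false

namespace Summit.ValiantsHypothesis.ValiantsHypothesis.Theorems.KPlusLogSqLaw

open Finset Classical

namespace StaticPathFold

noncomputable section

variable (w₁ w₀ : ℕ → ℝ)

/-! ## 1. Membership and bounds -/

/-- membership in `indepSets`. [folklore] -/
theorem mem_indepSets {i len : ℕ} {S : Finset ℕ} : S ∈ indepSets i len ↔ S ⊆ Ioc i (i + len) ∧ Indep S := by
  unfold indepSets; rw [mem_filter, mem_powerset]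

/-- every independent subset is bounded by the optimum. [folklore] -/
theorem sum_le_opt {i len : ℕ} {S : Finset ℕ} (hS : S ∈ indepSets i len) (θ : ℝ) :
    ∑ t ∈ S, W w₁ w₀ t θ ≤ opt w₁ w₀ i len θ :=
  le_sup' (fun S => ∑ t ∈ S, W w₁ w₀ t θ) hS

/-- the optimum is bounded by anything bounding every independent subset. [folklore] -/
theorem opt_le {i len : ℕ} {θ c : ℝ} (h : ∀ S ∈ indepSets i len, ∑ t ∈ S, W w₁ w₀ t θ ≤ c) : opt w₁ w₀ i len θ ≤ c :=
  sup'_le _ _ h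

/-- the optimum is attained. [folklore] -/
theorem exists_opt_eq (i len : ℕ) (θ : ℝ) : ∃ S ∈ indepSets i len, opt w₁ w₀ i len θ = ∑ t ∈ S, W w₁ w₀ t θ := by
  obtain ⟨S, hS, h⟩ := exists_mem_eq_sup' (⟨∅, empty_mem_indepSets i len⟩ : (indepSets i len).Nonempty)
    (fun S => ∑ t ∈ S, W w₁ w₀ t θ)
  exact ⟨S, hS, h⟩

/-- the empty block has optimum `0`. [folklore] -/
theorem opt_zero (i : ℕ) (θ : ℝ) : opt w₁ w₀ i 0 θ = 0 := by
  apply le_antisymm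
  · refine opt_le w₁ w₀ fun S hS => ?_
    have h : S = ∅ := by
      rcases mem_indepSets.mp hS with ⟨h1, _⟩
      exact subset_empty.mp (by simpa using h1)
    rw [h, sum_empty]
  · simpa using sum_le_opt w₁ w₀ (empty_mem_indepSets i 0) θ

/-- the one-item block has optimum `max 0 (W (i+1))`. [folklore] -/
theorem opt_one (i : ℕ) (θ : ℝ) : opt w₁ w₀ i 1 θ = max 0 (W w₁ w₀ (i + 1) θ) := by
  apply le_antisymm
  · refine opt_le w₁ w₀ fun S hS => ?_
    rcases mem_indepSets.mp hS with ⟨h1, _⟩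
    have h2 : S ⊆ {i + 1} := by
      intro t ht
      have := mem_Ioc.mp (h1 ht)
      rw [mem_singleton]; omega
    rcases subset_singleton_iff.mp h2 with h | h
    · rw [h, sum_empty]; exact le_max_left _ _
    · rw [h, sum_singleton]; exact le_max_right _ _
  · refine max_le ?_ ?_
    · simpa using sum_le_opt w₁ w₀ (empty_mem_indepSets i 1) θ
    · have h : ({i + 1} : Finset ℕ) ∈ indepSets i 1 := by
        rw [mem_indepSets]
        refine ⟨fun t ht => ?_, fun t ht h2 => ?_⟩
        · rw [mem_singleton] at ht; rw [mem_Ioc]; omega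
        · rw [mem_singleton] at ht h2; omega
      simpa using sum_le_opt w₁ w₀ h θ

/-! ## 2. The junction identity -/

/-- gluing: independent subsets of two blocks separated by at least one unused item form an independent subset of any
enclosing block. [folklore] -/
theorem union_mem_indepSets {i l₁ j l₂ L : ℕ} {A B : Finset ℕ} (hA : A ∈ indepSets i l₁) (hB : B ∈ indepSets j l₂)
    (hgap : i + l₁ < j) (hL : j + l₂ ≤ i + L) : A ∪ B ∈ indepSets i L := by
  rcases mem_indepSets.mp hA with ⟨hA1, hA2⟩
  rcases mem_indepSets.mp hB with ⟨hB1, hB2⟩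
  rw [mem_indepSets]
  refine ⟨fun t ht => ?_, fun t ht h2 => ?_⟩
  · rw [mem_Ioc]
    rcases mem_union.mp ht with h | h
    · have := mem_Ioc.mp (hA1 h); omega
    · have := mem_Ioc.mp (hB1 h); omega
  · rcases mem_union.mp ht with h | h
    · rcases mem_union.mp h2 with h' | h'
      · exact hA2 t h h'
      · have := mem_Ioc.mp (hA1 h); have := mem_Ioc.mp (hB1 h'); omega
    · rcases mem_union.mp h2 with h' | h'
      · have := mem_Ioc.mp (hB1 h); have := mem_Ioc.mp (hA1 h'); omega
      · exact hB2 t h h'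

/-- the sum over a glued set splits. [folklore] -/
theorem sum_union_of_blocks {i l₁ j l₂ : ℕ} {A B : Finset ℕ} (hA : A ∈ indepSets i l₁) (hB : B ∈ indepSets j l₂)
    (hgap : i + l₁ ≤ j) (θ : ℝ) :
    ∑ t ∈ A ∪ B, W w₁ w₀ t θ = ∑ t ∈ A, W w₁ w₀ t θ + ∑ t ∈ B, W w₁ w₀ t θ := by
  rcases mem_indepSets.mp hA with ⟨hA1, _⟩
  rcases mem_indepSets.mp hB with ⟨hB1, _⟩
  refine sum_union (disjoint_left.mpr fun t ha hb => ?_)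
  have := mem_Ioc.mp (hA1 ha); have := mem_Ioc.mp (hB1 hb); omega

/-- restriction: the part of an independent subset inside a sub-block is an independent subset of the sub-block. [folklore] -/
theorem inter_mem_indepSets {i len j m : ℕ} {S : Finset ℕ} (hS : S ∈ indepSets i len) :
    S ∩ Ioc j (j + m) ∈ indepSets j m := by
  rcases mem_indepSets.mp hS with ⟨_, h2⟩
  rw [mem_indepSets]
  refine ⟨fun t ht => (mem_inter.mp ht).2, fun t ht h' => h2 t (mem_inter.mp ht).1 (mem_inter.mp h').1⟩

/-- an independent subset avoiding the item `i + l + 1` splits after item `i + l`. [folklore] -/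
theorem eq_union_of_not_mem {i len l m : ℕ} {S : Finset ℕ} (hS : S ∈ indepSets i len)
    (hout : i + l + 1 ∉ S) (hm : i + len ≤ i + l + 1 + m) :
    S = S ∩ Ioc i (i + l) ∪ S ∩ Ioc (i + l + 1) (i + l + 1 + m) := by
  rcases mem_indepSets.mp hS with ⟨hS1, _⟩
  ext t
  simp only [mem_union, mem_inter, mem_Ioc]
  constructor
  · intro ht
    have h1 := mem_Ioc.mp (hS1 ht)
    have hne : t ≠ i + l + 1 := fun he => hout (he ▸ ht)
    by_cases h : t ≤ i + l
    · exact Or.inl ⟨ht, h1.1, h⟩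
    · exact Or.inr ⟨ht, by omega, by omega⟩
  · rintro (⟨ht, -⟩ | ⟨ht, -⟩) <;> exact ht

/-- **JUNCTION IDENTITY** (STATIC-PATH-NLOGN §6): across the junction after item `i + l₁`, that item or the next one is unused. [folklore] -/
theorem opt_junction (i l₁ l₂ : ℕ) (h₁ : 1 ≤ l₁) (h₂ : 1 ≤ l₂) (θ : ℝ) :
    opt w₁ w₀ i (l₁ + l₂) θ =
      max (opt w₁ w₀ i (l₁ - 1) θ + opt w₁ w₀ (i + l₁) l₂ θ) (opt w₁ w₀ i l₁ θ + opt w₁ w₀ (i + l₁ + 1) (l₂ - 1) θ) := by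
  apply le_antisymm
  · -- split an optimal set according to whether it uses item `i + l₁`
    obtain ⟨S, hS, hopt⟩ := exists_opt_eq w₁ w₀ i (l₁ + l₂) θ
    rw [hopt]
    rcases mem_indepSets.mp hS with ⟨hS1, hS2⟩
    by_cases hin : i + l₁ ∈ S
    · -- then `i + l₁ + 1 ∉ S`: split after item `i + l₁`
      have hout : i + l₁ + 1 ∉ S := hS2 _ hin
      have hAm : S ∩ Ioc i (i + l₁) ∈ indepSets i l₁ := inter_mem_indepSets hS
      have hBm : S ∩ Ioc (i + l₁ + 1) (i + l₁ + 1 + (l₂ - 1)) ∈ indepSets (i + l₁ + 1) (l₂ - 1) := inter_mem_indepSets hS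
      have hSAB := eq_union_of_not_mem (l := l₁) (m := l₂ - 1) hS hout (by omega)
      have hsum := sum_union_of_blocks w₁ w₀ hAm hBm (by omega) θ
      rw [← hSAB] at hsum
      rw [hsum]
      exact le_max_of_le_right (add_le_add (sum_le_opt w₁ w₀ hAm θ) (sum_le_opt w₁ w₀ hBm θ))
    · -- `i + l₁ ∉ S`: split after item `i + (l₁ - 1)`
      have hj : i + (l₁ - 1) + 1 = i + l₁ := by omega
      have hout : i + (l₁ - 1) + 1 ∉ S := by rw [hj]; exact hin
      have hAm : S ∩ Ioc i (i + (l₁ - 1)) ∈ indepSets i (l₁ - 1) := inter_mem_indepSets hS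
      have hBm : S ∩ Ioc (i + (l₁ - 1) + 1) (i + (l₁ - 1) + 1 + l₂) ∈ indepSets (i + (l₁ - 1) + 1) l₂ :=
        inter_mem_indepSets hS
      have hSAB := eq_union_of_not_mem (l := l₁ - 1) (m := l₂) hS hout (by omega)
      have hsum := sum_union_of_blocks w₁ w₀ hAm hBm (by omega) θ
      rw [← hSAB] at hsum
      rw [hsum]
      have e2 : ∑ t ∈ S ∩ Ioc (i + (l₁ - 1) + 1) (i + (l₁ - 1) + 1 + l₂), W w₁ w₀ t θ ≤ opt w₁ w₀ (i + l₁) l₂ θ := by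
        rw [← hj]; exact sum_le_opt w₁ w₀ hBm θ
      exact le_max_of_le_left (add_le_add (sum_le_opt w₁ w₀ hAm θ) e2)
  · -- gluing optimal sets of the two parts
    refine max_le ?_ ?_
    · obtain ⟨A, hA, hAopt⟩ := exists_opt_eq w₁ w₀ i (l₁ - 1) θ
      obtain ⟨B, hB, hBopt⟩ := exists_opt_eq w₁ w₀ (i + l₁) l₂ θ
      have hU : A ∪ B ∈ indepSets i (l₁ + l₂) := union_mem_indepSets hA hB (by omega) (by omega)
      rw [hAopt, hBopt, ← sum_union_of_blocks w₁ w₀ hA hB (by omega) θ]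
      exact sum_le_opt w₁ w₀ hU θ
    · obtain ⟨A, hA, hAopt⟩ := exists_opt_eq w₁ w₀ i l₁ θ
      obtain ⟨B, hB, hBopt⟩ := exists_opt_eq w₁ w₀ (i + l₁ + 1) (l₂ - 1) θ
      have hU : A ∪ B ∈ indepSets i (l₁ + l₂) := union_mem_indepSets hA hB (by omega) (by omega)
      rw [hAopt, hBopt, ← sum_union_of_blocks w₁ w₀ hA hB (by omega) θ]
      exact sum_le_opt w₁ w₀ hU θ

/-! ## 3. The dynamic programme -/

/-- the shifted item lines: `W (shift i w₁) (shift i w₀) t = W w₁ w₀ (i + t)`. [folklore] -/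
theorem W_shift (i t : ℕ) (θ : ℝ) : W (shift i w₁) (shift i w₀) t θ = W w₁ w₀ (i + t) θ := rfl

/-- `F` is non-decreasing in the number of items. [folklore] -/
theorem F_le_F_succ (a b : ℕ → ℝ) (k : ℕ) (θ : ℝ) : F a b k θ ≤ F a b (k + 1) θ := by
  rw [F_succ_eq]; have := Δ_nonneg a b (k + 1) θ; linarith

/-- **the block optimum is the dynamic programme on the shifted items**: `opt i k = F (shift i) k`. [folklore] -/
theorem opt_eq_F (i : ℕ) : ∀ k : ℕ, ∀ θ : ℝ, opt w₁ w₀ i k θ = F (shift i w₁) (shift i w₀) k θ := by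
  intro k
  induction k using Nat.strong_induction_on with
  | _ k ih =>
    intro θ
    match k, ih with
    | 0, _ => rw [opt_zero]; rfl
    | 1, _ => rw [opt_one]; rfl
    | k + 2, ih =>
      rw [show k + 2 = (k + 1) + 1 from rfl, opt_junction w₁ w₀ i (k + 1) 1 (by omega) le_rfl θ, F_add_two]
      rw [Nat.add_sub_cancel, Nat.sub_self, opt_zero, add_zero, opt_one, ih k (by omega) θ, ih (k + 1) (by omega) θ]
      rw [show i + (k + 1) + 1 = i + (k + 2) by ring, ← W_shift w₁ w₀ i (k + 2)]
      -- `max (F k + max 0 w) (F (k+1)) = max (F (k+1)) (F k + w)` since `F k ≤ F (k+1)`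
      have hmono := F_le_F_succ (shift i w₁) (shift i w₀) k θ
      set w := W (shift i w₁) (shift i w₀) (k + 2) θ
      rcases le_total 0 w with hw | hw
      · rw [max_eq_right hw]; exact max_comm _ _
      · rw [max_eq_left hw, add_zero, max_eq_right hmono, max_eq_left (by linarith)]

/-- **the left train of a block**: `opt i (k+1) - opt i k = Δ (shift i) (k+1)`. [folklore] -/
theorem opt_sub_eq_Δ (i k : ℕ) (θ : ℝ) :
    opt w₁ w₀ i (k + 1) θ - opt w₁ w₀ i k θ = Δ (shift i w₁) (shift i w₀) (k + 1) θ := by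
  rw [opt_eq_F, opt_eq_F, F_succ_eq]; ring

end

end StaticPathFold

end Summit.ValiantsHypothesis.ValiantsHypothesis.Theorems.KPlusLogSqLaw
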